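import Mathlib
import Summits.AtomisticToContinuum.Crystallization.Theorems.BraggSlacknessRigidityHcpDiffractionRigidityLocalLimitTransferAux
import Summits.AtomisticToContinuum.Crystallization.Theorems.BraggSlacknessRigidityHcpDiffractionRigidityEssentialPeriodicityRatAux

/-!
# Gaussian-tested intensities of a separated set: the finite pair-correlation bound
# (stub `stub_essentialPeriodicityRat` of crux `HcpDiffractionRigidity`,
# item `stmt-AtomisticToContinuum-13166`, Aux file 2)

Let `Λ ⊆ ℝ³` be `r`-separated, `c` real weights and `τ(r,A) = e^{-πA²r²/2} · 2(2/r+1)³(8/A²+1)³`.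

* `sum_exp_le_of_le_norm`, `sum_exp_sub_le` — Gaussian sums `∑ e^{-πA²|u|²}` over `r`-separated
  finite families avoiding the ball of radius `r` are `≤ τ(r,A)`;
* `sum_sum_gauss_le` — the finite pair-correlation bound: if `|p - q - z₀| ≥ r` whenever
  `p, q ∈ Λ` and `p - q ≠ z₀`, then for every finite window `T` of `Λ`,
  `∑_{s,s' ∈ T} c(s)c(s') A³ e^{-πA²|s-s'-z₀|²}
  ≤ A³ (½ ∑_T 1[s-z₀ ∈ Λ] c² + ½ ∑_T 1[s+z₀ ∈ Λ] c² + τ ∑_T c²)` (arithmetic–geometric mean; in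
  each row/column at most one exact coincidence, the rest is a Gaussian sum `≤ τ`);
* `integral_gauss_cos_normSq_window` — the modulated Gaussian identity of Aux file 1 at scale `A`;
* summability of the (indicator-restricted) squared weights.

All `[folklore]`.
-/

noncomputable section

namespace Summit.AtomisticToContinuum.Crystallization.Theorems

namespace HcpRigiditySpectral

open MeasureTheory Complex Filter Metric Set
open scoped BigOperators Real RealInnerProductSpace ComplexConjugate Topology Classical
open Summit.AtomisticToContinuum.Crystallization.Theorems.HcpRigidityDenseCentres
open Summit.AtomisticToContinuum.Crystallization.Theorems.HcpRigidityWindows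
open Summit.AtomisticToContinuum.Crystallization.Theorems.HcpRigidityLocalLimit

/-! ## Gaussian sums over separated finite families avoiding a ball -/

/-- For an `r`-separated finite configuration `y` of `ℝ³` and `A > 0`,
`∑_{|yᵢ| ≥ r} e^{-πA²|yᵢ|²} ≤ e^{-πA²r²/2} · 2(2/r+1)³(8/A²+1)³` (split off `e^{-πA²r²/2}` and use the
uniform Gaussian sums `HcpRigidityLocalLimit.sum_exp_neg_mul_sq_le` at rate `πA²/2`). [folklore] -/
theorem sum_exp_le_of_le_norm {N : ℕ} (y : Fin N → EuclideanSpace ℝ (Fin 3)) {r : ℝ} (hr : 0 < r)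
    (hsep : ∀ i j, i ≠ j → r ≤ dist (y i) (y j)) {A : ℝ} (hA : 0 < A) :
    ∑ i, (if r ≤ ‖y i‖ then Real.exp (-(Real.pi * A ^ 2 * ‖y i‖ ^ 2)) else 0) ≤
      Real.exp (-(Real.pi * A ^ 2 * r ^ 2 / 2)) * (2 * (2 / r + 1) ^ 3 * (8 / A ^ 2 + 1) ^ 3) := by
  set a : ℝ := Real.pi * A ^ 2 / 2 with ha
  have ha0 : 0 < a := by positivity
  have key : ∀ i, (if r ≤ ‖y i‖ then Real.exp (-(Real.pi * A ^ 2 * ‖y i‖ ^ 2)) else 0) ≤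
      Real.exp (-(Real.pi * A ^ 2 * r ^ 2 / 2)) * Real.exp (-a * ‖y i‖ ^ 2) := by
    intro i
    split_ifs with h
    · rw [← Real.exp_add, Real.exp_le_exp, ha]
      have h2 : r ^ 2 ≤ ‖y i‖ ^ 2 := pow_le_pow_left₀ hr.le h 2
      have h3 : 0 < Real.pi * A ^ 2 := by positivity
      nlinarith [mul_le_mul_of_nonneg_left h2 h3.le]
    · positivity
  have hb := sum_exp_neg_mul_sq_le y hr hsep ha0
  have e8 : 4 * Real.pi / a = 8 / A ^ 2 := by
    rw [ha]; field_simp; ring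
  rw [e8] at hb
  calc ∑ i, (if r ≤ ‖y i‖ then Real.exp (-(Real.pi * A ^ 2 * ‖y i‖ ^ 2)) else 0)
      ≤ ∑ i, Real.exp (-(Real.pi * A ^ 2 * r ^ 2 / 2)) * Real.exp (-a * ‖y i‖ ^ 2) :=
        Finset.sum_le_sum fun i _ => key i
    _ = Real.exp (-(Real.pi * A ^ 2 * r ^ 2 / 2)) * ∑ i, Real.exp (-a * ‖y i‖ ^ 2) := by
        rw [Finset.mul_sum]
    _ ≤ _ := by gcongr

/-- **Row sums.** For a finite window `T` of an `r`-separated `Λ ⊆ ℝ³`, `A > 0` and a vector `w`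
such that `|s - w| ≥ r` for all `s ∈ Λ` with `s ≠ w`:
`∑_{s ∈ T, s ≠ w} e^{-πA²|s-w|²} ≤ e^{-πA²r²/2} · 2(2/r+1)³(8/A²+1)³`. [folklore] -/
theorem sum_exp_sub_le {Λ : Set (EuclideanSpace ℝ (Fin 3))} {r : ℝ} (hr : 0 < r)
    (hΛ : ∀ p ∈ Λ, ∀ q ∈ Λ, p ≠ q → r ≤ dist p q) {A : ℝ} (hA : 0 < A) (T : Finset Λ)
    (w : EuclideanSpace ℝ (Fin 3)) (hw : ∀ s ∈ Λ, s - w ≠ 0 → r ≤ ‖s - w‖) :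
    ∑ s ∈ T, (if (s : EuclideanSpace ℝ (Fin 3)) - w = 0 then 0 else
        Real.exp (-(Real.pi * A ^ 2 * ‖(s : EuclideanSpace ℝ (Fin 3)) - w‖ ^ 2))) ≤
      Real.exp (-(Real.pi * A ^ 2 * r ^ 2 / 2)) * (2 * (2 / r + 1) ^ 3 * (8 / A ^ 2 + 1) ^ 3) := by
  set g : EuclideanSpace ℝ (Fin 3) → ℝ := fun u =>
    if r ≤ ‖u - w‖ then Real.exp (-(Real.pi * A ^ 2 * ‖u - w‖ ^ 2)) else 0 with hg
  have hle : ∀ s ∈ T, (if (s : EuclideanSpace ℝ (Fin 3)) - w = 0 then 0 else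
      Real.exp (-(Real.pi * A ^ 2 * ‖(s : EuclideanSpace ℝ (Fin 3)) - w‖ ^ 2))) ≤ g s := by
    intro s _
    by_cases h1 : (s : EuclideanSpace ℝ (Fin 3)) - w = 0
    · rw [if_pos h1]; simp only [hg]; split_ifs <;> positivity
    · rw [if_neg h1]; simp only [hg]; rw [if_pos (hw s s.2 h1)]
  refine (Finset.sum_le_sum hle).trans (sum_finset_le_of_forall hΛ (fun N y hy => ?_) T)
  have hsep : ∀ i j, i ≠ j → r ≤ dist (y i - w) (y j - w) := fun i j hij => by
    rw [dist_sub_right]; exact hy i j hij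
  simpa only [hg] using sum_exp_le_of_le_norm (fun i => y i - w) hr hsep hA

/-! ## The finite pair-correlation bound -/

/-- In a window `T` of `Λ`, for fixed `s` at most one `s'` has `s - s' = z₀`, and none unless
`s - z₀ ∈ Λ`. [folklore] -/
theorem sum_row_indicator_le {Λ : Set (EuclideanSpace ℝ (Fin 3))} (T : Finset Λ) (s : Λ)
    (z₀ : EuclideanSpace ℝ (Fin 3)) :
    ∑ s' ∈ T, (if (s : EuclideanSpace ℝ (Fin 3)) - s' - z₀ = 0 then (1 : ℝ) else 0) ≤
      if (s : EuclideanSpace ℝ (Fin 3)) - z₀ ∈ Λ then 1 else 0 := by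
  have key : ∀ s' : Λ, (s : EuclideanSpace ℝ (Fin 3)) - s' - z₀ = 0 →
      (s' : EuclideanSpace ℝ (Fin 3)) = s - z₀ := fun s' h => by
    rw [sub_right_comm, sub_eq_zero] at h; exact h.symm
  rw [Finset.sum_boole]
  split_ifs with h
  · have : (T.filter fun s' : Λ => (s : EuclideanSpace ℝ (Fin 3)) - s' - z₀ = 0).card ≤ 1 := by
      refine Finset.card_le_one.2 fun a ha b hb => Subtype.ext ?_
      rw [Finset.mem_filter] at ha hb
      rw [key a ha.2, key b hb.2]
    exact_mod_cast this
  · have : (T.filter fun s' : Λ => (s : EuclideanSpace ℝ (Fin 3)) - s' - z₀ = 0).card = 0 := by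
      refine Finset.card_eq_zero.2 (Finset.filter_eq_empty_iff.2 fun s' _ h' => h ?_)
      rw [← key s' h']; exact s'.2
    rw [this]; norm_num

/-- In a window `T` of `Λ`, for fixed `s'` at most one `s` has `s - s' = z₀`, and none unless
`s' + z₀ ∈ Λ`. [folklore] -/
theorem sum_col_indicator_le {Λ : Set (EuclideanSpace ℝ (Fin 3))} (T : Finset Λ) (s' : Λ)
    (z₀ : EuclideanSpace ℝ (Fin 3)) :
    ∑ s ∈ T, (if (s : EuclideanSpace ℝ (Fin 3)) - s' - z₀ = 0 then (1 : ℝ) else 0) ≤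
      if (s' : EuclideanSpace ℝ (Fin 3)) + z₀ ∈ Λ then 1 else 0 := by
  have key : ∀ s : Λ, (s : EuclideanSpace ℝ (Fin 3)) - s' - z₀ = 0 →
      (s : EuclideanSpace ℝ (Fin 3)) = s' + z₀ := fun s h => by
    rw [sub_sub, sub_eq_zero] at h; exact h
  rw [Finset.sum_boole]
  split_ifs with h
  · have : (T.filter fun s : Λ => (s : EuclideanSpace ℝ (Fin 3)) - s' - z₀ = 0).card ≤ 1 := by
      refine Finset.card_le_one.2 fun a ha b hb => Subtype.ext ?_
      rw [Finset.mem_filter] at ha hb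
      rw [key a ha.2, key b hb.2]
    exact_mod_cast this
  · have : (T.filter fun s : Λ => (s : EuclideanSpace ℝ (Fin 3)) - s' - z₀ = 0).card = 0 := by
      refine Finset.card_eq_zero.2 (Finset.filter_eq_empty_iff.2 fun s _ h' => h ?_)
      rw [← key s h']; exact s.2
    rw [this]; norm_num

/-- **The finite pair-correlation bound.** Let `Λ ⊆ ℝ³` be `r`-separated, `c ≥ 0`, `A > 0`, and
`z₀` such that `|p - q - z₀| ≥ r` for all `p, q ∈ Λ` with `p - q ≠ z₀`. Then for every finite
window `T`, `∑_{s,s' ∈ T} c(s)c(s') A³ e^{-πA²|s-s'-z₀|²} ≤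
A³ (½ ∑_T 1[s-z₀ ∈ Λ] c(s)² + ½ ∑_T 1[s+z₀ ∈ Λ] c(s)² + τ(r,A) ∑_T c(s)²)`
(arithmetic–geometric mean `c(s)c(s') ≤ ½(c(s)² + c(s')²)`; in each row/column at most one
exact coincidence `s - s' = z₀`, and the remaining Gaussian sum is `≤ τ(r,A)`). [folklore] -/
theorem sum_sum_gauss_le {Λ : Set (EuclideanSpace ℝ (Fin 3))} {r : ℝ} (hr : 0 < r)
    (hΛ : ∀ p ∈ Λ, ∀ q ∈ Λ, p ≠ q → r ≤ dist p q) {A : ℝ} (hA : 0 < A)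
    (c : EuclideanSpace ℝ (Fin 3) → ℝ) (T : Finset Λ) {z₀ : EuclideanSpace ℝ (Fin 3)}
    (hz₀ : ∀ p ∈ Λ, ∀ q ∈ Λ, p - q - z₀ ≠ 0 → r ≤ ‖p - q - z₀‖) :
    ∑ s ∈ T, ∑ s' ∈ T, c s * c s' * (A ^ 3 *
        Real.exp (-(Real.pi * A ^ 2 * ‖(s : EuclideanSpace ℝ (Fin 3)) - s' - z₀‖ ^ 2))) ≤
      A ^ 3 * ((∑ s ∈ T, if (s : EuclideanSpace ℝ (Fin 3)) - z₀ ∈ Λ then c s ^ 2 else 0) / 2 +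
        (∑ s ∈ T, if (s : EuclideanSpace ℝ (Fin 3)) + z₀ ∈ Λ then c s ^ 2 else 0) / 2 +
        Real.exp (-(Real.pi * A ^ 2 * r ^ 2 / 2)) * (2 * (2 / r + 1) ^ 3 * (8 / A ^ 2 + 1) ^ 3) *
          ∑ s ∈ T, c s ^ 2) := by
  set τ : ℝ := Real.exp (-(Real.pi * A ^ 2 * r ^ 2 / 2)) *
    (2 * (2 / r + 1) ^ 3 * (8 / A ^ 2 + 1) ^ 3) with hτ
  set G : Λ → Λ → ℝ := fun s s' =>
    Real.exp (-(Real.pi * A ^ 2 * ‖(s : EuclideanSpace ℝ (Fin 3)) - s' - z₀‖ ^ 2)) with hG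
  have hG0 : ∀ s s', 0 ≤ G s s' := fun _ _ => (Real.exp_pos _).le
  -- exact coincidences and the rest
  have hGsplit : ∀ s s', G s s' = (if (s : EuclideanSpace ℝ (Fin 3)) - s' - z₀ = 0 then (1 : ℝ) else 0) +
      (if (s : EuclideanSpace ℝ (Fin 3)) - s' - z₀ = 0 then 0 else G s s') := by
    intro s s'
    split_ifs with h
    · simp only [hG, h, norm_zero, add_zero]; simp
    · simp
  -- row sums
  have hrow : ∀ s : Λ, ∑ s' ∈ T, G s s' ≤ (if (s : EuclideanSpace ℝ (Fin 3)) - z₀ ∈ Λ then 1 else 0) + τ := by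
    intro s
    rw [Finset.sum_congr rfl fun s' _ => hGsplit s s', Finset.sum_add_distrib]
    refine add_le_add (sum_row_indicator_le T s z₀) ?_
    have h1 : ∀ s' : Λ, (s : EuclideanSpace ℝ (Fin 3)) - s' - z₀ =
        -((s' : EuclideanSpace ℝ (Fin 3)) - ((s : EuclideanSpace ℝ (Fin 3)) - z₀)) := fun s' => by abel
    have h2 : ∀ s' : Λ, (if (s : EuclideanSpace ℝ (Fin 3)) - s' - z₀ = 0 then (0 : ℝ) else G s s') =
        (if (s' : EuclideanSpace ℝ (Fin 3)) - ((s : EuclideanSpace ℝ (Fin 3)) - z₀) = 0 then 0 else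
          Real.exp (-(Real.pi * A ^ 2 *
            ‖(s' : EuclideanSpace ℝ (Fin 3)) - ((s : EuclideanSpace ℝ (Fin 3)) - z₀)‖ ^ 2))) := by
      intro s'; simp only [hG, h1 s', neg_eq_zero, norm_neg]
    rw [Finset.sum_congr rfl fun s' _ => h2 s']
    refine sum_exp_sub_le hr hΛ hA T _ fun s' hs' hne => ?_
    have h3 : (s : EuclideanSpace ℝ (Fin 3)) - s' - z₀ =
        -(s' - ((s : EuclideanSpace ℝ (Fin 3)) - z₀)) := by abel
    have := hz₀ s s.2 s' hs' (by rw [h3, neg_ne_zero]; exact hne)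
    rwa [h3, norm_neg] at this
  -- column sums
  have hcol : ∀ s' : Λ, ∑ s ∈ T, G s s' ≤ (if (s' : EuclideanSpace ℝ (Fin 3)) + z₀ ∈ Λ then 1 else 0) + τ := by
    intro s'
    rw [Finset.sum_congr rfl fun s _ => hGsplit s s', Finset.sum_add_distrib]
    refine add_le_add (sum_col_indicator_le T s' z₀) ?_
    have h1 : ∀ s : Λ, (s : EuclideanSpace ℝ (Fin 3)) - s' - z₀ =
        (s : EuclideanSpace ℝ (Fin 3)) - ((s' : EuclideanSpace ℝ (Fin 3)) + z₀) := fun s => sub_sub _ _ _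
    have h2 : ∀ s : Λ, (if (s : EuclideanSpace ℝ (Fin 3)) - s' - z₀ = 0 then (0 : ℝ) else G s s') =
        (if (s : EuclideanSpace ℝ (Fin 3)) - ((s' : EuclideanSpace ℝ (Fin 3)) + z₀) = 0 then 0 else
          Real.exp (-(Real.pi * A ^ 2 *
            ‖(s : EuclideanSpace ℝ (Fin 3)) - ((s' : EuclideanSpace ℝ (Fin 3)) + z₀)‖ ^ 2))) := by
      intro s; simp only [hG, h1 s]
    rw [Finset.sum_congr rfl fun s _ => h2 s]
    refine sum_exp_sub_le hr hΛ hA T _ fun s hs hne => ?_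
    have := hz₀ s hs s' s'.2 (by rw [sub_sub]; exact hne)
    rwa [sub_sub] at this
  -- termwise arithmetic–geometric mean
  have hterm : ∀ s ∈ T, ∀ s' ∈ T, c s * c s' * (A ^ 3 * G s s') ≤
      A ^ 3 / 2 * (c s ^ 2 * G s s') + A ^ 3 / 2 * (c s' ^ 2 * G s s') := by
    intro s _ s' _
    have h2 : c s * c s' ≤ (c s ^ 2 + c s' ^ 2) / 2 := by nlinarith [sq_nonneg (c s - c s')]
    have hA3 : 0 ≤ A ^ 3 * G s s' := by positivity
    nlinarith [mul_le_mul_of_nonneg_right h2 hA3]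
  have hpart1 : ∑ s ∈ T, ∑ s' ∈ T, A ^ 3 / 2 * (c s ^ 2 * G s s') =
      A ^ 3 / 2 * ∑ s ∈ T, c s ^ 2 * ∑ s' ∈ T, G s s' := by
    rw [Finset.mul_sum]
    refine Finset.sum_congr rfl fun s _ => ?_
    rw [Finset.mul_sum, Finset.mul_sum]
  have hpart2 : ∑ s ∈ T, ∑ s' ∈ T, A ^ 3 / 2 * (c s' ^ 2 * G s s') =
      A ^ 3 / 2 * ∑ s' ∈ T, c s' ^ 2 * ∑ s ∈ T, G s s' := by
    rw [Finset.sum_comm, Finset.mul_sum]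
    refine Finset.sum_congr rfl fun s' _ => ?_
    rw [Finset.mul_sum, Finset.mul_sum]
  have hfin : ∀ (P : Λ → Prop), ∑ s ∈ T, c s ^ 2 * ((if P s then (1 : ℝ) else 0) + τ) =
      (∑ s ∈ T, if P s then c s ^ 2 else 0) + τ * ∑ s ∈ T, c s ^ 2 := by
    intro P
    rw [Finset.mul_sum, ← Finset.sum_add_distrib]
    exact Finset.sum_congr rfl fun s _ => by split_ifs <;> ring
  calc ∑ s ∈ T, ∑ s' ∈ T, c s * c s' * (A ^ 3 * G s s')
      ≤ ∑ s ∈ T, ∑ s' ∈ T, (A ^ 3 / 2 * (c s ^ 2 * G s s') + A ^ 3 / 2 * (c s' ^ 2 * G s s')) :=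
        Finset.sum_le_sum fun s hs => Finset.sum_le_sum fun s' hs' => hterm s hs s' hs'
    _ = (∑ s ∈ T, ∑ s' ∈ T, A ^ 3 / 2 * (c s ^ 2 * G s s')) +
          ∑ s ∈ T, ∑ s' ∈ T, A ^ 3 / 2 * (c s' ^ 2 * G s s') := by
        rw [← Finset.sum_add_distrib]
        exact Finset.sum_congr rfl fun s _ => Finset.sum_add_distrib
    _ = A ^ 3 / 2 * ∑ s ∈ T, c s ^ 2 * ∑ s' ∈ T, G s s' +
          A ^ 3 / 2 * ∑ s' ∈ T, c s' ^ 2 * ∑ s ∈ T, G s s' := by rw [hpart1, hpart2]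
    _ ≤ A ^ 3 / 2 * ∑ s ∈ T, c s ^ 2 * ((if (s : EuclideanSpace ℝ (Fin 3)) - z₀ ∈ Λ then 1 else 0) + τ) +
          A ^ 3 / 2 * ∑ s' ∈ T, c s' ^ 2 *
            ((if (s' : EuclideanSpace ℝ (Fin 3)) + z₀ ∈ Λ then 1 else 0) + τ) := by
        have hA3 : 0 ≤ A ^ 3 / 2 := by positivity
        gcongr with s hs s' hs'
        · exact hrow s
        · exact hcol s'
    _ = _ := by
        rw [hfin (fun s : Λ => (s : EuclideanSpace ℝ (Fin 3)) - z₀ ∈ Λ),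
          hfin (fun s : Λ => (s : EuclideanSpace ℝ (Fin 3)) + z₀ ∈ Λ)]
        ring

/-! ## Passage to `Λ` -/

/-- The Gaussian constants at `σ = π/A²`: `(π/σ)^{3/2} = A³` and `π²|v|²/σ = πA²|v|²`. [folklore] -/
theorem gaussConst_scale {A : ℝ} (hA : 0 < A) (v : EuclideanSpace ℝ (Fin 3)) :
    (Real.pi / (Real.pi / A ^ 2)) ^ ((3 : ℝ) / 2) * Real.exp (-(Real.pi ^ 2 * ‖v‖ ^ 2 / (Real.pi / A ^ 2))) =
      A ^ 3 * Real.exp (-(Real.pi * A ^ 2 * ‖v‖ ^ 2)) := by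
  have hπ := Real.pi_pos
  have h1 : Real.pi / (Real.pi / A ^ 2) = A ^ 2 := by field_simp
  have h2 : (A ^ 2) ^ ((3 : ℝ) / 2) = A ^ 3 := by
    rw [← Real.rpow_natCast A 2, ← Real.rpow_mul hA.le]; norm_num
  have h3 : Real.pi ^ 2 * ‖v‖ ^ 2 / (Real.pi / A ^ 2) = Real.pi * A ^ 2 * ‖v‖ ^ 2 := by
    field_simp
  rw [h1, h2, h3]

/-- The modulated Gaussian identity of Aux file 1 at scale `A` for a finite window of `Λ`:
`∫ e^{-π|ξ|²/A²} cos(2π⟨ξ,z₀⟩)|S_T|² = ∑_{s,s' ∈ T} c(s)c(s') A³ e^{-πA²|s-s'-z₀|²}`. [folklore] -/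
theorem integral_gauss_cos_normSq_window {Λ : Set (EuclideanSpace ℝ (Fin 3))} (T : Finset Λ)
    (c : EuclideanSpace ℝ (Fin 3) → ℝ) {A : ℝ} (hA : 0 < A) (z₀ : EuclideanSpace ℝ (Fin 3)) :
    ∫ ξ : EuclideanSpace ℝ (Fin 3), Real.exp (-(Real.pi / A ^ 2) * ‖ξ‖ ^ 2) * Real.cos (2 * Real.pi * ⟪ξ, z₀⟫) *
        ‖∑ s ∈ T, (c s : ℂ) * cexp (2 * Real.pi * I * (⟪ξ, (s : EuclideanSpace ℝ (Fin 3))⟫ : ℂ))‖ ^ 2 =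
      ∑ s ∈ T, ∑ s' ∈ T, c s * c s' * (A ^ 3 *
        Real.exp (-(Real.pi * A ^ 2 * ‖(s : EuclideanSpace ℝ (Fin 3)) - s' - z₀‖ ^ 2))) := by
  rw [integral_gauss_cos_normSq_sum T (fun s : Λ => c s) (by positivity : 0 < Real.pi / A ^ 2)
    (fun s : Λ => (s : EuclideanSpace ℝ (Fin 3))) z₀]
  exact Finset.sum_congr rfl fun s _ => Finset.sum_congr rfl fun s' _ => by rw [gaussConst_scale hA]

/-- The squared weights are summable. [folklore] -/
theorem summable_sq_of_summable {Λ : Set (EuclideanSpace ℝ (Fin 3))} {c : EuclideanSpace ℝ (Fin 3) → ℝ}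
    (hc0 : ∀ z, 0 ≤ c z) (hcs : Summable fun s : Λ => c s) : Summable fun s : Λ => c s ^ 2 := by
  have hle : ∀ s : Λ, c s ≤ ∑' t : Λ, c t := fun s => hcs.le_tsum s fun t _ => hc0 _
  refine (hcs.mul_left (∑' t : Λ, c t)).of_nonneg_of_le (fun s => sq_nonneg _) fun s => ?_
  rw [sq]
  exact mul_le_mul_of_nonneg_right (hle s) (hc0 _)

/-- Indicator-restricted squared weights are summable. [folklore] -/
theorem summable_ite_sq {Λ : Set (EuclideanSpace ℝ (Fin 3))} {c : EuclideanSpace ℝ (Fin 3) → ℝ}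
    (hc0 : ∀ z, 0 ≤ c z) (hcs : Summable fun s : Λ => c s) (P : Λ → Prop) [DecidablePred P] :
    Summable fun s : Λ => if P s then c s ^ 2 else 0 :=
  (summable_sq_of_summable hc0 hcs).of_nonneg_of_le
    (fun s => by split_ifs <;> positivity) fun s => by split_ifs <;> simp [sq_nonneg]

/-- Complementary indicator-restricted squared weights (summable). [folklore] -/
theorem summable_ite_zero_sq {Λ : Set (EuclideanSpace ℝ (Fin 3))} {c : EuclideanSpace ℝ (Fin 3) → ℝ}
    (hc0 : ∀ z, 0 ≤ c z) (hcs : Summable fun s : Λ => c s) (P : Λ → Prop) [DecidablePred P] :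
    Summable fun s : Λ => if P s then 0 else c s ^ 2 :=
  (summable_sq_of_summable hc0 hcs).of_nonneg_of_le
    (fun s => by split_ifs <;> positivity) fun s => by split_ifs <;> simp [sq_nonneg]

end HcpRigiditySpectral

open scoped Classical

/-- **Registered helper stub of `stub_essentialPeriodicityRat` (Aux file 2): the finite
pair-correlation bound.** For an `r`-separated `Λ ⊆ ℝ³`, real weights `c`, `A > 0`, `z₀` with
`|p - q - z₀| ≥ r` for all `p, q ∈ Λ`, `p - q ≠ z₀`, and a finite window `T` of `Λ`:
`∑_{s,s' ∈ T} c(s)c(s') A³ e^{-πA²|s-s'-z₀|²} ≤ A³ (½ ∑_T 1[s-z₀ ∈ Λ] c² + ½ ∑_T 1[s+z₀ ∈ Λ] c² + τ(r,A) ∑_T c²)`,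
`τ(r,A) = e^{-πA²r²/2} · 2(2/r+1)³(8/A²+1)³`. [folklore] -/
theorem stub_essentialPeriodicityRatPairBound : ∀ (r : ℝ), 0 < r → ∀ Λ : Set (EuclideanSpace ℝ (Fin 3)), (∀ p ∈ Λ, ∀ q ∈ Λ, p ≠ q → r ≤ dist p q) → ∀ (A : ℝ), 0 < A → ∀ (c : EuclideanSpace ℝ (Fin 3) → ℝ) (T : Finset Λ) (z₀ : EuclideanSpace ℝ (Fin 3)), (∀ p ∈ Λ, ∀ q ∈ Λ, p - q - z₀ ≠ 0 → r ≤ ‖p - q - z₀‖) → ∑ s ∈ T, ∑ s' ∈ T, c (s : EuclideanSpace ℝ (Fin 3)) * c (s' : EuclideanSpace ℝ (Fin 3)) * (A ^ 3 * Real.exp (-(Real.pi * A ^ 2 * ‖(s : EuclideanSpace ℝ (Fin 3)) - (s' : EuclideanSpace ℝ (Fin 3)) - z₀‖ ^ 2))) ≤ A ^ 3 * ((∑ s ∈ T, if (s : EuclideanSpace ℝ (Fin 3)) - z₀ ∈ Λ then c (s : EuclideanSpace ℝ (Fin 3)) ^ 2 else 0) / 2 + (∑ s ∈ T, if (s : EuclideanSpace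 ℝ (Fin 3)) + z₀ ∈ Λ then c (s : EuclideanSpace ℝ (Fin 3)) ^ 2 else 0) / 2 + Real.exp (-(Real.pi * A ^ 2 * r ^ 2 / 2)) * (2 * (2 / r + 1) ^ 3 * (8 / A ^ 2 + 1) ^ 3) * ∑ s ∈ T, c (s : EuclideanSpace ℝ (Fin 3)) ^ 2) :=
  fun _ hr _ hΛ _ hA c T _ hz₀ => HcpRigiditySpectral.sum_sum_gauss_le hr hΛ hA c T hz₀

end Summit.AtomisticToContinuum.Crystallization.Theorems

end
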